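import Summits.QuantumFields.QCD.Theses.HeatSlicedQuarks
import Summits.QuantumFields.QCD.Theorems.HeatSlicedQuarksQuarkLoopCoefficientDefs
import Summits.QuantumFields.QCD.Theorems.HeatSlicedQuarksQuarkLoopCoefficientHeatSeries
import Summits.QuantumFields.QCD.Theorems.HeatSlicedQuarksQuarkLoopCoefficientHeatSeriesB
import Summits.QuantumFields.QCD.Theorems.HeatSlicedQuarksQuarkLoopCoefficientSymmetricGauge
import Summits.QuantumFields.QCD.Theorems.HeatSlicedQuarksQuarkLoopCoefficientHeatLocality

/-!
# Twisted convolutions on `ℤ⁴`: lattice sums, entry bounds, associativity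
(line `Sketch` of crux stmt-QuantumFields-16786, Duhamel layer, part 2)

Toolkit for the twisted Duhamel formula (`…QuarkLoopCoefficientTwistedDuhamel`), written for an
abstract phase `Ω : ℤ⁴ → ℤ⁴ → ℂ` of modulus at most one (the magnetic-translation cocycle
`Ω_θ(v, w) = e^{(iθ/2) v∧w}` of the line), a range-two kernel `H` (the symbol `ȟ_θ` of `D♯D`) and
spin-matrix valued functions on `ℤ⁴`, everything ENTRYWISE:

* `Σ_{y ∈ ℤ⁴} e^{−|y|₁} < ∞` (product of four two-sided geometric series) and the resulting
  domination criterion for sums over `ℤ⁴`; evaluation of a matrix `tsum` at an entry;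
* entry bounds of products, of phase-weighted products and of twisted finite sums over `nbr2`;
* transfer of the decay weight `e^{−|y|₁}` across a range-two step;
* **associativity of the twisted convolution with a finitely supported middle factor**:
  `Σ_y Ω(y,w) ((Σ_{v ∈ nbr2 y} Ω(v,y) F(v) H(y−v)) G(w−y))_{αβ}
     = Σ_y Ω(y,w) (F(y) (Σ_{k ∈ nbr2 0} Ω(k,w−y) H(k) G(w−y−k)))_{αβ}`
  under the cocycle identity `Ω(y,w) Ω(y−k,y) = Ω(y−k,w) Ω(k,w−(y−k))`, for `F` decaying like
  `e^{−|y|₁}` and `G` bounded (reindex `v = y − k`, swap the finite sum with the series, shift `y`).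
-/

noncomputable section

namespace Summit.QuantumFields.QCD.Cruxes.QuarkLoopCoefficient.Sketch.TwistedDuhamel

open Literature.MathematicalPhysics.QuantumLattice Literature.MathematicalPhysics.QuantumFieldTheory
open Literature.Probability.LatticeModels (Site)
open Summit.QuantumFields.QCD.Theorems.QuarkLoopCoefficient
open Summit.QuantumFields.QCD.Cruxes.QuarkLoopCoefficient.Sketch.HeatSeries
open Summit.QuantumFields.QCD.Cruxes.QuarkLoopCoefficient.Sketch.SymmetricGauge
open Summit.QuantumFields.QCD.Cruxes.QuarkLoopCoefficient.Sketch.HeatLocality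
open scoped Matrix ComplexConjugate

/-! ## §1 Lattice sums -/

/-- `Σ_{n ∈ ℤ} e^{−|n|} < ∞`. -/
theorem summable_exp_neg_abs_int : Summable fun n : ℤ => Real.exp (-|((n : ℤ) : ℝ)|) := by
  refine summable_int_iff_summable_nat_and_neg.mpr ⟨?_, ?_⟩
  · simpa using Real.summable_exp_neg_nat
  · simpa using Real.summable_exp_neg_nat

/-- Coordinatewise products of a nonnegative summable sequence are summable on `ℤᵈ`. -/
theorem summable_pi_prod {a : ℤ → ℝ} (ha : Summable a) (ha0 : 0 ≤ a) :
    ∀ d : ℕ, Summable fun y : Fin d → ℤ => ∏ μ : Fin d, a (y μ)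
  | 0 => Summable.of_finite
  | d + 1 => by
    have hg0 : 0 ≤ fun y : Fin d → ℤ => ∏ μ : Fin d, a (y μ) :=
      fun y => Finset.prod_nonneg fun μ _ => ha0 (y μ)
    have hprod : Summable fun p : ℤ × (Fin d → ℤ) => a p.1 * ∏ μ : Fin d, a (p.2 μ) :=
      Summable.mul_of_nonneg (f := a) (g := fun y : Fin d → ℤ => ∏ μ : Fin d, a (y μ)) ha
        (summable_pi_prod ha ha0 d) ha0 hg0
    refine (Equiv.summable_iff (Fin.consEquiv fun _ : Fin (d + 1) => ℤ)).mp (hprod.congr fun p => ?_)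
    show a p.1 * ∏ μ, a (p.2 μ) = ∏ μ : Fin (d + 1), a ((Fin.cons p.1 p.2 : Fin (d + 1) → ℤ) μ)
    rw [Fin.prod_univ_succ]
    simp only [Fin.cons_zero, Fin.cons_succ]

/-- `Σ_{y ∈ ℤ⁴} e^{−|y|₁} < ∞`. -/
theorem summable_exp_neg_l1 :
    Summable fun y : Site 4 => Real.exp (-(∑ μ : Fin 4, |((y μ : ℤ) : ℝ)|)) := by
  refine (summable_pi_prod summable_exp_neg_abs_int (fun n => (Real.exp_pos _).le) 4).congr
    fun y => ?_
  rw [← Finset.sum_neg_distrib, Real.exp_sum]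

/-- Domination by `C e^{−|y|₁}` gives summability over `ℤ⁴`. -/
theorem summable_of_le_exp {g : Site 4 → ℂ} (C : ℝ)
    (h : ∀ y, ‖g y‖ ≤ C * Real.exp (-(∑ μ : Fin 4, |((y μ : ℤ) : ℝ)|))) : Summable g :=
  Summable.of_norm_bounded (summable_exp_neg_l1.mul_left C) h

/-- Evaluation of a matrix-valued sum over `ℤ⁴` at an entry, under entrywise summability. -/
theorem tsum_apply_apply {Mf : Site 4 → Spin} (h : ∀ α β : Fin 4, Summable fun y => Mf y α β)
    (α β : Fin 4) : (∑' y, Mf y) α β = ∑' y, Mf y α β := by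
  have hs : Summable Mf := Pi.summable.mpr fun a => Pi.summable.mpr fun b => h a b
  have e1 : (∑' y, Mf y) α = ∑' y, Mf y α := tsum_apply hs
  have e2 : (∑' y, Mf y α) β = ∑' y, Mf y α β := tsum_apply (Pi.summable.mp hs α)
  rw [show (∑' y, Mf y) α β = ((∑' y, Mf y) α) β from rfl, e1, e2]

/-! ## §2 Entry bounds -/

/-- Entry bound of a product of two spin matrices. -/
theorem norm_mul_apply_le {A B : Spin} {a b : ℝ} (hA : ∀ α β, ‖A α β‖ ≤ a)
    (hB : ∀ α β, ‖B α β‖ ≤ b) (α β : Fin 4) : ‖(A * B) α β‖ ≤ 4 * (a * b) := by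
  rw [Matrix.mul_apply]
  refine (norm_sum_le _ _).trans ?_
  calc ∑ γ, ‖A α γ * B γ β‖ ≤ ∑ _γ : Fin 4, a * b := Finset.sum_le_sum fun γ _ => by
        rw [norm_mul]
        exact mul_le_mul (hA α γ) (hB γ β) (norm_nonneg _) ((norm_nonneg _).trans (hA α γ))
    _ = 4 * (a * b) := by
        simp only [Finset.sum_const, Finset.card_univ, Fintype.card_fin, nsmul_eq_mul, Nat.cast_ofNat]

/-- Entry bound of a phase times a product of two spin matrices. -/
theorem norm_phase_mul_mul_apply_le {c : ℂ} (hc : ‖c‖ ≤ 1) {A B : Spin} {a b : ℝ}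
    (hA : ∀ α β, ‖A α β‖ ≤ a) (hB : ∀ α β, ‖B α β‖ ≤ b) (α β : Fin 4) :
    ‖c * (A * B) α β‖ ≤ 4 * (a * b) := by
  rw [norm_mul]
  calc ‖c‖ * ‖(A * B) α β‖ ≤ 1 * (4 * (a * b)) :=
        mul_le_mul hc (norm_mul_apply_le hA hB α β) (norm_nonneg _) zero_le_one
    _ = 4 * (a * b) := one_mul _

/-- Entry bound of a twisted finite sum `Σ_{v ∈ S} c(v) • (A v * B v)` over at most `81` points. -/
theorem norm_sum_smul_mul_apply_le {S : Finset (Site 4)} (hS : S.card ≤ 81) {c : Site 4 → ℂ}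
    (hc : ∀ v, ‖c v‖ ≤ 1) {A B : Site 4 → Spin} {a b : ℝ} (ha : 0 ≤ a) (hb : 0 ≤ b)
    (hA : ∀ v ∈ S, ∀ α β, ‖A v α β‖ ≤ a) (hB : ∀ v ∈ S, ∀ α β, ‖B v α β‖ ≤ b) (α β : Fin 4) :
    ‖(∑ v ∈ S, c v • (A v * B v)) α β‖ ≤ 81 * (4 * (a * b)) := by
  rw [Matrix.sum_apply]
  refine (norm_sum_le _ _).trans ?_
  calc ∑ v ∈ S, ‖(c v • (A v * B v)) α β‖ ≤ ∑ _v ∈ S, 4 * (a * b) :=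
        Finset.sum_le_sum fun v hv => by
          rw [Matrix.smul_apply, smul_eq_mul]
          exact norm_phase_mul_mul_apply_le (hc v) (hA v hv) (hB v hv) α β
    _ = S.card * (4 * (a * b)) := by rw [Finset.sum_const, nsmul_eq_mul]
    _ ≤ 81 * (4 * (a * b)) := mul_le_mul_of_nonneg_right (by exact_mod_cast hS) (by positivity)

/-! ## §3 Range-two geometry at the origin and decay transfer -/

/-- `v ∈ nbr2 y → y − v ∈ nbr2 0`. -/
theorem sub_mem_nbr2_zero {y v : Site 4} (hv : v ∈ nbr2 y) : y - v ∈ nbr2 0 := by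
  have h := (mem_nbr2_add (x := (0 : Site 4)) (v := v) (z := y))
  rw [zero_add] at h
  exact h.mp (mem_nbr2_comm.mp hv)

/-- `k ∈ nbr2 0 → y − k ∈ nbr2 y`. -/
theorem sub_mem_nbr2 (y : Site 4) {k : Site 4} (hk : k ∈ nbr2 0) : y - k ∈ nbr2 y := by
  refine mem_nbr2_comm.mpr ?_
  have h := (mem_nbr2_add (x := (0 : Site 4)) (v := y - k) (z := y))
  rw [zero_add, sub_sub_cancel] at h
  exact h.mpr hk

/-- Across a range-two step the `ℓ¹` size changes by at most two. -/
theorem l1_le_of_mem_nbr2 {y v : Site 4} (hv : v ∈ nbr2 y) :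
    (∑ μ : Fin 4, |((y μ : ℤ) : ℝ)|) ≤ (∑ μ : Fin 4, |((v μ : ℤ) : ℝ)|) + 2 := by
  have h2 : (∑ μ : Fin 4, |((v μ - y μ : ℤ) : ℝ)|) ≤ 2 := by
    rw [l1_cast]; exact_mod_cast l1_le_two_of_mem_nbr2 hv
  have htri : (∑ μ : Fin 4, |((y μ : ℤ) : ℝ)|) ≤
      (∑ μ : Fin 4, |((v μ : ℤ) : ℝ)|) + ∑ μ : Fin 4, |((v μ - y μ : ℤ) : ℝ)| := by
    rw [← Finset.sum_add_distrib]
    refine Finset.sum_le_sum fun μ _ => ?_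
    have h := abs_sub_abs_le_abs_sub ((y μ : ℤ) : ℝ) ((v μ : ℤ) : ℝ)
    rw [abs_sub_comm] at h
    push_cast
    linarith
  linarith

/-- Decay transfer across a range-two step: for `v ∈ nbr2 y`, `e^{−|v|₁} ≤ e² e^{−|y|₁}`. -/
theorem exp_neg_l1_le_of_mem_nbr2 {y v : Site 4} (hv : v ∈ nbr2 y) :
    Real.exp (-(∑ μ : Fin 4, |((v μ : ℤ) : ℝ)|)) ≤
      Real.exp 2 * Real.exp (-(∑ μ : Fin 4, |((y μ : ℤ) : ℝ)|)) := by
  rw [← Real.exp_add]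
  exact Real.exp_le_exp.mpr (by linarith [l1_le_of_mem_nbr2 hv])

/-! ## §4 Bounds of the three twisted summands of the Duhamel computation -/

variable (Ω : Site 4 → Site 4 → ℂ) (H : Site 4 → Spin)

/-- The plain summand `Ω(y,w) (F(y) G(w'))_{αβ}`: `‖·‖ ≤ 4 K_F e^{−|y|₁} K_G`. -/
theorem norm_phase_term_le (hΩ1 : ∀ v w, ‖Ω v w‖ ≤ 1) {F G : Site 4 → Spin} {KF KG : ℝ}
    (hF : ∀ y α β, ‖F y α β‖ ≤ KF * Real.exp (-(∑ μ : Fin 4, |((y μ : ℤ) : ℝ)|)))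
    (hG : ∀ y α β, ‖G y α β‖ ≤ KG) (w y w' : Site 4) (α β : Fin 4) :
    ‖Ω y w * (F y * G w') α β‖ ≤ 4 * (KF * Real.exp (-(∑ μ : Fin 4, |((y μ : ℤ) : ℝ)|)) * KG) :=
  norm_phase_mul_mul_apply_le (hΩ1 y w) (hF y) (hG w') α β

/-- The left-twisted summand `Ω(y,w) ((Σ_{v ∈ nbr2 y} Ω(v,y) F(v) H(y−v)) G(w'))_{αβ}`:
`‖·‖ ≤ 4 · (81 · 4 · K_F e² e^{−|y|₁} K_H) · K_G`. -/
theorem norm_left_term_le (hΩ1 : ∀ v w, ‖Ω v w‖ ≤ 1) {KH : ℝ} (hKH : 0 ≤ KH)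
    (hH : ∀ v α β, ‖H v α β‖ ≤ KH) {F G : Site 4 → Spin} {KF KG : ℝ} (hKF : 0 ≤ KF)
    (hF : ∀ y α β, ‖F y α β‖ ≤ KF * Real.exp (-(∑ μ : Fin 4, |((y μ : ℤ) : ℝ)|)))
    (hG : ∀ y α β, ‖G y α β‖ ≤ KG) (w y w' : Site 4) (α β : Fin 4) :
    ‖Ω y w * ((∑ v ∈ nbr2 y, Ω v y • (F v * H (y - v))) * G w') α β‖ ≤
      4 * (81 * (4 * (KF * Real.exp 2 * Real.exp (-(∑ μ : Fin 4, |((y μ : ℤ) : ℝ)|)) * KH)) * KG) := by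
  refine norm_phase_mul_mul_apply_le (hΩ1 y w) (fun α' β' => ?_) (hG w') α β
  refine norm_sum_smul_mul_apply_le (card_nbr2_le y) (fun v => hΩ1 v y) (by positivity) hKH
    (fun v hv α'' β'' => (hF v α'' β'').trans ?_) (fun v _ α'' β'' => hH (y - v) α'' β'') α' β'
  rw [mul_assoc]
  exact mul_le_mul_of_nonneg_left (exp_neg_l1_le_of_mem_nbr2 hv) hKF

/-- The right-twisted summand `Ω(y,w) (F(y) (Σ_{k ∈ nbr2 0} Ω(k,w') H(k) G(w' − k)))_{αβ}`:
`‖·‖ ≤ 4 · K_F e^{−|y|₁} · (81 · 4 · K_H K_G)`. -/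
theorem norm_right_term_le (hΩ1 : ∀ v w, ‖Ω v w‖ ≤ 1) {KH : ℝ} (hKH : 0 ≤ KH)
    (hH : ∀ v α β, ‖H v α β‖ ≤ KH) {F G : Site 4 → Spin} {KF KG : ℝ} (hKG : 0 ≤ KG)
    (hF : ∀ y α β, ‖F y α β‖ ≤ KF * Real.exp (-(∑ μ : Fin 4, |((y μ : ℤ) : ℝ)|)))
    (hG : ∀ y α β, ‖G y α β‖ ≤ KG) (w y w' : Site 4) (α β : Fin 4) :
    ‖Ω y w * (F y * (∑ k ∈ nbr2 0, Ω k w' • (H k * G (w' - k)))) α β‖ ≤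
      4 * (KF * Real.exp (-(∑ μ : Fin 4, |((y μ : ℤ) : ℝ)|)) * (81 * (4 * (KH * KG)))) :=
  norm_phase_mul_mul_apply_le (hΩ1 y w) (hF y) (fun α' β' =>
    norm_sum_smul_mul_apply_le (card_nbr2_le 0) (fun k => hΩ1 k w') hKH hKG
      (fun k _ α'' β'' => hH k α'' β'') (fun k _ α'' β'' => hG (w' - k) α'' β'') α' β') α β

/-! ## §5 Associativity of the twisted convolution -/

/-- **Associativity of the twisted convolution with a finitely supported middle factor**, entrywise:
`Σ_y Ω(y,w) ((Σ_{v ∈ nbr2 y} Ω(v,y) F(v) H(y−v)) G(w−y))_{αβ}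
  = Σ_y Ω(y,w) (F(y) (Σ_{k ∈ nbr2 0} Ω(k,w−y) H(k) G(w−y−k)))_{αβ}`,
for a phase of modulus at most one obeying the cocycle identity, `F` decaying like `e^{−|y|₁}` and
`G` bounded (reindex `v = y − k`, swap the finite `k`-sum with the `y`-series, shift `y ↦ y − k`). -/
theorem twisted_assoc (hΩ1 : ∀ v w, ‖Ω v w‖ ≤ 1)
    (hΩc : ∀ y k w, Ω y w * Ω (y - k) y = Ω (y - k) w * Ω k (w - (y - k)))
    {KH : ℝ} (hH : ∀ v α β, ‖H v α β‖ ≤ KH) {F G : Site 4 → Spin} {KF KG : ℝ}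
    (hF : ∀ y α β, ‖F y α β‖ ≤ KF * Real.exp (-(∑ μ : Fin 4, |((y μ : ℤ) : ℝ)|)))
    (hG : ∀ y α β, ‖G y α β‖ ≤ KG) (w : Site 4) (α β : Fin 4) :
    ∑' y, Ω y w * ((∑ v ∈ nbr2 y, Ω v y • (F v * H (y - v))) * G (w - y)) α β =
      ∑' y, Ω y w * (F y * (∑ k ∈ nbr2 0, Ω k (w - y) • (H k * G (w - y - k)))) α β := by
  -- the summand family of the right-hand side
  set f : Site 4 → Site 4 → ℂ :=
    fun k y => Ω y w * Ω k (w - y) * (F y * (H k * G (w - y - k))) α β with hf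
  have hfs : ∀ k, Summable (f k) := by
    intro k
    refine summable_of_le_exp (4 * (KF * (4 * (KH * KG)))) fun y => ?_
    have h1 : ‖Ω y w * Ω k (w - y)‖ ≤ 1 := by
      rw [norm_mul]
      calc ‖Ω y w‖ * ‖Ω k (w - y)‖ ≤ 1 * 1 :=
            mul_le_mul (hΩ1 _ _) (hΩ1 _ _) (norm_nonneg _) zero_le_one
        _ = 1 := one_mul 1
    calc ‖f k y‖ ≤ 4 * (KF * Real.exp (-(∑ μ : Fin 4, |((y μ : ℤ) : ℝ)|)) * (4 * (KH * KG))) :=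
          norm_phase_mul_mul_apply_le h1 (hF y)
            (fun α' β' => norm_mul_apply_le (hH k) (hG (w - y - k)) α' β') α β
      _ = 4 * (KF * (4 * (KH * KG))) * Real.exp (-(∑ μ : Fin 4, |((y μ : ℤ) : ℝ)|)) := by ring
  have hfs' : ∀ k, Summable fun y => f k (y - k) := fun k =>
    (Equiv.summable_iff (Equiv.subRight k)).mpr (hfs k)
  -- both sides as series of finite `k`-sums
  have hR : ∀ y, Ω y w * (F y * (∑ k ∈ nbr2 0, Ω k (w - y) • (H k * G (w - y - k)))) α β =
      ∑ k ∈ nbr2 0, f k y := by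
    intro y
    rw [Matrix.mul_sum, Matrix.sum_apply, Finset.mul_sum]
    refine Finset.sum_congr rfl fun k _ => ?_
    rw [hf, Matrix.mul_smul, Matrix.smul_apply, smul_eq_mul, ← mul_assoc]
  have hL : ∀ y, Ω y w * ((∑ v ∈ nbr2 y, Ω v y • (F v * H (y - v))) * G (w - y)) α β =
      ∑ k ∈ nbr2 0, f k (y - k) := by
    intro y
    rw [Matrix.sum_mul, Matrix.sum_apply, Finset.mul_sum]
    refine Finset.sum_nbij' (fun v => y - v) (fun k => y - k) (fun v hv => sub_mem_nbr2_zero hv)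
      (fun k hk => sub_mem_nbr2 y hk) (fun v _ => sub_sub_cancel y v) (fun k _ => sub_sub_cancel y k)
      fun v _ => ?_
    have hc := hΩc y (y - v) w
    rw [sub_sub_cancel] at hc
    simp only [hf, sub_sub_cancel, sub_sub_sub_cancel_right]
    rw [Matrix.smul_mul, Matrix.smul_apply, smul_eq_mul, ← mul_assoc, hc, Matrix.mul_assoc]
  calc ∑' y, Ω y w * ((∑ v ∈ nbr2 y, Ω v y • (F v * H (y - v))) * G (w - y)) α β
      = ∑' y, ∑ k ∈ nbr2 0, f k (y - k) := tsum_congr hL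
    _ = ∑ k ∈ nbr2 0, ∑' y, f k (y - k) := Summable.tsum_finsetSum fun k _ => hfs' k
    _ = ∑ k ∈ nbr2 0, ∑' y, f k y :=
        Finset.sum_congr rfl fun k _ => (Equiv.subRight k).tsum_eq (f k)
    _ = ∑' y, ∑ k ∈ nbr2 0, f k y := (Summable.tsum_finsetSum fun k _ => hfs k).symm
    _ = _ := (tsum_congr hR).symm

/-! ## Registered headline -/

/-- Registered headline of this helper file (aux stub `stub_twistedDuhamelAux` of crux
stmt-QuantumFields-16786, line `Sketch`): the lattice sum `Σ_{y ∈ ℤ⁴} e^{−|y|₁}` converges. -/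
theorem stub_twistedDuhamelAux :
    Summable fun y : Site 4 => Real.exp (-(∑ μ : Fin 4, |((y μ : ℤ) : ℝ)|)) :=
  summable_exp_neg_l1

end Summit.QuantumFields.QCD.Cruxes.QuarkLoopCoefficient.Sketch.TwistedDuhamel

end
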